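import Summits.CriticalPhenomena.PercolationContinuityZ3.Theorems.PercNearOneGluingNoHeavyLowerTailFourPointAtoms
import Literature.Probability.LatticeModels.HarrisPartialResampling
import HarnessLib

/-!
# The port row `R_x` of the three-port transfer for Conjecture W (row `Q44`): a Harris consequence

Support file for crux `stmt-CriticalPhenomena-4575` (master-family programme; Conjecture W = `TwoCopyMono.GoodKernel kerQ44`,
open for all `n`), seat `prim-l12-p6` gen 27; memo `run/shared/lean/prim/prim-l12/FROM-prim-l12-p6-g27-PORT-TRANSFER.md` §2–§3.

THE THREE-PORT TRANSFER (memo §1): for `G = K ⊕_{b,c,y} R` (K = the side of `a`), Conjecture W for `G` is the quadratic form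
`C_qq q² + q(C_qb u_b + C_qc u_c + C_qy u_y + C_qx x) + C_bc u_bu_c + C_by u_bu_y + C_cy u_cu_y` in the three-point law of `(b,c,y)` in `R`,
and `W(K ⊕ R) ≥ 0` for every `R` iff eight inequalities hold for `K`, one of which is `C_qx(K) ≥ 0`.  As a row in the cells
`cᵢ = FourPointAtoms.cell w a b c y i` of `(a,b,c,y)` in `K` it reads
`R_x :  (c₀+c₁+c₂+c₃+c₇)(c₅+c₆) ≤ 2·c₀·(c₄+c₅+c₆+c₈+c₉+c₁₀+c₁₁+c₁₂+c₁₃+c₁₄)`,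
i.e. `P(a ≁ b,c,y)·[P(ab|c|y)+P(ac|b|y)] ≤ 2·P(a|b|c|y)·P(a joined to a terminal)`.  PROVED HERE on every finite weighted graph from ONE
Harris inequality: the events `U = {a↔b} ∪ {a↔c} ∪ {a↔y}` and `V = {b↔c} ∪ {b↔y} ∪ {c↔y}` are increasing, so `P(U)P(V) ≤ P(U ∩ V)`,
which in cells is `ConjWPort.iso_single_le`: `(c₀+c₁+c₂+c₃+c₇)(c₄+c₅+c₆) ≤ c₀(c₄+c₅+c₆+c₈+⋯+c₁₄)`; `R_x` follows with a factor 2 to spare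
(`ConjWPort.portRow_x_cells`).  (The companion rows `R_cy` — certified over Gladkov's sunflower + type-B + SS7, memo §2 — and the open
`R_bc`, `R_by` are not in this file.)  No sorries, no named facts, no definitions, standard axioms.
-/

noncomputable section

namespace Summit.CriticalPhenomena.PercolationContinuityZ3.Theorems

namespace ConjWPort

open MeasureTheory Set Literature.Probability.LatticeModels Literature.Probability.Percolation
open FourPointAtoms
open Summit.CriticalPhenomena.PercolationContinuityZ3.Cruxes.AdditiveGluing.TieLine.ConnAtoms
open scoped Classical

variable {n : ℕ}

/-- **Harris for "a reaches a terminal" and "two of b,c,y are joined", in four-point cells**: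
`P(a ≁ b,c,y)·P(a joined to exactly one terminal, the other two separated) ≤ P(a|b|c|y)·P(a joined to a terminal)`, i.e.
`(c₀+c₁+c₂+c₃+c₇)(c₄+c₅+c₆) ≤ c₀(c₄+c₅+c₆+c₈+c₉+c₁₀+c₁₁+c₁₂+c₁₃+c₁₄)`. [this work] -/
theorem iso_single_le (w : Sym2 (Fin n) → unitInterval) (a b c y : Fin n) :
    (cell w a b c y 0 + cell w a b c y 1 + cell w a b c y 2 + cell w a b c y 3 + cell w a b c y 7) *
        (cell w a b c y 4 + cell w a b c y 5 + cell w a b c y 6) ≤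
      cell w a b c y 0 * (cell w a b c y 4 + cell w a b c y 5 + cell w a b c y 6 + cell w a b c y 8 + cell w a b c y 9 +
        cell w a b c y 10 + cell w a b c y 11 + cell w a b c y 12 + cell w a b c y 13 + cell w a b c y 14) := by
  -- the two increasing events
  have hU : IsUpperSet ((openConn a b ∪ openConn a c ∪ openConn a y : Set (BondConfig (Fin n)))) :=
    ((isUpperSet_openConn a b).union (isUpperSet_openConn a c)).union (isUpperSet_openConn a y)
  have hV : IsUpperSet ((openConn b c ∪ openConn b y ∪ openConn c y : Set (BondConfig (Fin n)))) :=
    ((isUpperSet_openConn b c).union (isUpperSet_openConn b y)).union (isUpperSet_openConn c y)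
  have h := prodBernoulli_harris_via_resample w hU hV
  -- the three probabilities as cell sums
  have pU : HasPattern (quad a b c y) (openConn a b ∪ openConn a c ∪ openConn a y : Set (BondConfig (Fin n)))
      (fun π => (π 0 = π 1 ∨ π 0 = π 2) ∨ π 0 = π 3) :=
    ((oc a b c y 0 1 rfl rfl).union (oc a b c y 0 2 rfl rfl)).union (oc a b c y 0 3 rfl rfl)
  have pV : HasPattern (quad a b c y) (openConn b c ∪ openConn b y ∪ openConn c y : Set (BondConfig (Fin n)))
      (fun π => (π 1 = π 2 ∨ π 1 = π 3) ∨ π 2 = π 3) :=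
    ((oc a b c y 1 2 rfl rfl).union (oc a b c y 1 3 rfl rfl)).union (oc a b c y 2 3 rfl rfl)
  have eU : (prodBernoulli w).real (openConn a b ∪ openConn a c ∪ openConn a y : Set (BondConfig (Fin n))) =
      cell w a b c y 4 + cell w a b c y 5 + cell w a b c y 6 + cell w a b c y 8 + cell w a b c y 9 + cell w a b c y 10 +
        cell w a b c y 11 + cell w a b c y 12 + cell w a b c y 13 + cell w a b c y 14 := by
    rw [measureReal_eq_cellSum w a b c y pU]
    simp (config := {decide := true}) only [ite_true, ite_false]; ring
  have eV : (prodBernoulli w).real (openConn b c ∪ openConn b y ∪ openConn c y : Set (BondConfig (Fin n))) =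
      cell w a b c y 1 + cell w a b c y 2 + cell w a b c y 3 + cell w a b c y 7 + cell w a b c y 8 + cell w a b c y 9 +
        cell w a b c y 10 + cell w a b c y 11 + cell w a b c y 12 + cell w a b c y 13 + cell w a b c y 14 := by
    rw [measureReal_eq_cellSum w a b c y pV]
    simp (config := {decide := true}) only [ite_true, ite_false]; ring
  have eUV : (prodBernoulli w).real ((openConn a b ∪ openConn a c ∪ openConn a y : Set (BondConfig (Fin n))) ∩
        (openConn b c ∪ openConn b y ∪ openConn c y)) =
      cell w a b c y 8 + cell w a b c y 9 + cell w a b c y 10 + cell w a b c y 11 + cell w a b c y 12 + cell w a b c y 13 +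
        cell w a b c y 14 := by
    rw [measureReal_eq_cellSum w a b c y (pU.inter pV)]
    simp (config := {decide := true}) only [ite_true, ite_false]; ring
  rw [eU, eV, eUV] at h
  have hsum := sum_cell_eq_one w a b c y
  -- multiply the normalisation by the two factors that occur
  have hT : (cell w a b c y 4 + cell w a b c y 5 + cell w a b c y 6 + cell w a b c y 8 + cell w a b c y 9 + cell w a b c y 10 +
        cell w a b c y 11 + cell w a b c y 12 + cell w a b c y 13 + cell w a b c y 14) *
      (cell w a b c y 0 + cell w a b c y 1 + cell w a b c y 2 + cell w a b c y 3 + cell w a b c y 4 + cell w a b c y 5 +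
        cell w a b c y 6 + cell w a b c y 7 + cell w a b c y 8 + cell w a b c y 9 + cell w a b c y 10 + cell w a b c y 11 +
        cell w a b c y 12 + cell w a b c y 13 + cell w a b c y 14) =
      cell w a b c y 4 + cell w a b c y 5 + cell w a b c y 6 + cell w a b c y 8 + cell w a b c y 9 + cell w a b c y 10 +
        cell w a b c y 11 + cell w a b c y 12 + cell w a b c y 13 + cell w a b c y 14 := by
    rw [hsum, mul_one]
  have hS : (cell w a b c y 4 + cell w a b c y 5 + cell w a b c y 6) *
      (cell w a b c y 0 + cell w a b c y 1 + cell w a b c y 2 + cell w a b c y 3 + cell w a b c y 4 + cell w a b c y 5 +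
        cell w a b c y 6 + cell w a b c y 7 + cell w a b c y 8 + cell w a b c y 9 + cell w a b c y 10 + cell w a b c y 11 +
        cell w a b c y 12 + cell w a b c y 13 + cell w a b c y 14) =
      cell w a b c y 4 + cell w a b c y 5 + cell w a b c y 6 := by
    rw [hsum, mul_one]
  linarith [h, hT, hS]

/-- **The port row `R_x` of the three-port transfer** (memo §2; = the criterion coefficient `C_qx(K) ≥ 0`), on every finite weighted graph:
`(c₀+c₁+c₂+c₃+c₇)(c₅+c₆) ≤ 2·c₀·(c₄+c₅+c₆+c₈+c₉+c₁₀+c₁₁+c₁₂+c₁₃+c₁₄)`. [this work] -/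
theorem portRow_x_cells (w : Sym2 (Fin n) → unitInterval) (a b c y : Fin n) :
    (cell w a b c y 0 + cell w a b c y 1 + cell w a b c y 2 + cell w a b c y 3 + cell w a b c y 7) *
        (cell w a b c y 5 + cell w a b c y 6) ≤
      2 * (cell w a b c y 0 * (cell w a b c y 4 + cell w a b c y 5 + cell w a b c y 6 + cell w a b c y 8 + cell w a b c y 9 +
        cell w a b c y 10 + cell w a b c y 11 + cell w a b c y 12 + cell w a b c y 13 + cell w a b c y 14)) := by
  have h := iso_single_le w a b c y
  have h0 := cell_nonneg w a b c y 0; have h1 := cell_nonneg w a b c y 1; have h2 := cell_nonneg w a b c y 2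
  have h3 := cell_nonneg w a b c y 3; have h4 := cell_nonneg w a b c y 4; have h5 := cell_nonneg w a b c y 5
  have h6 := cell_nonneg w a b c y 6; have h7 := cell_nonneg w a b c y 7; have h8 := cell_nonneg w a b c y 8
  have h9 := cell_nonneg w a b c y 9; have h10 := cell_nonneg w a b c y 10; have h11 := cell_nonneg w a b c y 11
  have h12 := cell_nonneg w a b c y 12; have h13 := cell_nonneg w a b c y 13; have h14 := cell_nonneg w a b c y 14
  have hiso4 : 0 ≤ (cell w a b c y 0 + cell w a b c y 1 + cell w a b c y 2 + cell w a b c y 3 + cell w a b c y 7) * cell w a b c y 4 :=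
    mul_nonneg (by linarith) h4
  have hgood : 0 ≤ cell w a b c y 0 * (cell w a b c y 4 + cell w a b c y 5 + cell w a b c y 6 + cell w a b c y 8 + cell w a b c y 9 +
        cell w a b c y 10 + cell w a b c y 11 + cell w a b c y 12 + cell w a b c y 13 + cell w a b c y 14) :=
    mul_nonneg h0 (by linarith)
  linarith [h, hiso4, hgood]

end ConjWPort

end Summit.CriticalPhenomena.PercolationContinuityZ3.Theorems
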